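import Summits.QuantumFields.YangMills.Theorems.LuscherReductionTwistedTraceScalingBOCoreTransfer
import HarnessLib

/-!
# (C2/C3-inner) THE CORE TRANSFER FROM THE CENTRAL QUASIMODE ON THE INNER CORE: the fibre-point range of (C1) decoupled from the support radius of the profile
# (lane A of S-BASE, crux `TwistedTraceScaling` stmt-QuantumFields-20203, C4-CORE, the (OD) pen; `pub/ym-fleet/ym-luscher-20007-p1/COARSE-DESIGN.md` §28.3 (ii))

★★★ `colour_fpFibreTransfer_two_sided_inner` — `…BOCoreTransfer.colour_fpFibreTransfer_two_sided` verbatim, except that the central quasimode hypothesis `hC1` is required only for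
fibre points of the INNER core `‖linkEmbed v''‖ ≤ R_in` (`R_in ≤ R`, `R` = support radius of `Ω` in `hΩt`), and accordingly the conclusion is stated for output fibre points with
`‖linkEmbed v'‖ ≤ R_in`.  The proof uses `hC1` only at colour rotations of `v'`, which preserve `‖linkEmbed ·‖`, the caps and the per-link sizes.  This is the form (C1) can deliver
(`…BOCentralTransfer.central_transfer_two_sided_chart`: two-sided bounds hold at inner-core fibre points only — gauge-far and near-boundary fibre points belong to the (C5) tails).
HONEST FRAMING: glue bookkeeping for a stub of a child of the CONDITIONAL route R2b1; (C1) rates, (C4), (C5), (B-ST) OPEN; C4-CORE OPEN; not infinite volume, not a gap, not Clay.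
-/

set_option autoImplicit false

noncomputable section

open MeasureTheory Filter Topology Real
open scoped BigOperators
open Literature.MathematicalPhysics.QuantumFieldTheory
open Literature.MathematicalPhysics.QuantumLattice

namespace Summit.QuantumFields.YangMills.Theorems.FemtoTransferGap.TwoLattice.ConstTube

open Summit.QuantumFields.YangMills.Theorems.FemtoTransferGap
open Summit.QuantumFields.YangMills.Theorems.FemtoTransferGap.TwoLattice
open Summit.QuantumFields.YangMills.Theorems.FemtoTransferGap.TwoLattice.Avg
open Summit.QuantumFields.YangMills.Theorems.FemtoTransferGap.TwoLattice.Stiff (LinkSpace)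
open Summit.QuantumFields.YangMills.Theorems.FemtoTransferGap.TwoLattice.Cov (sum_sq_adRot_mulVec)
open Summit.QuantumFields.YangMills.Theorems.TwistedTraceScaling.Negative.R33 (gaugeTransform_const_orthoTube)

variable {L : ℕ} [NeZero L]

/-- ★★★ **CORE TRANSFER FROM THE CENTRAL QUASIMODE ON THE INNER CORE** (see the module docstring; hypotheses as in `colour_fpFibreTransfer_two_sided` with `hC1` and the output
fibre point restricted to `‖linkEmbed ·‖ ≤ R_in ≤ R`). [cite: Luscher1983, §3] -/
theorem colour_fpFibreTransfer_two_sided_inner {β : ℝ} (hβ : 0 ≤ β) {Ω : LinkSpace L → ℝ} (hΩm : Measurable Ω) {CΩ : ℝ} (hCΩ : ∀ x, |Ω x| ≤ CΩ) (hΩ0 : ∀ x, 0 ≤ Ω x)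
    {W : (Site 3 L → SU2) → ℝ} (hW : Measurable W) {CW : ℝ} (hCW : ∀ g, |W g| ≤ CW) (hW0 : ∀ g, 0 ≤ W g)
    {δ δu T R Γ σ : ℝ} (hδ1 : δ ≤ 1 / 2) (hα1 : δ + δu ≤ 1) (hT0 : 0 ≤ T) (hT : T ≤ 1 / 30) (hσ : σ < 2)
    (hΩt : ∀ v : Edge 3 L → Fin 3 → ℝ, Ω (linkEmbed L v) ≠ 0 → v ∈ capBalancedSet L ∧ (∀ (e : Edge 3 L) (c : Fin 3), |v e c| ≤ T) ∧ ‖linkEmbed L v‖ ≤ R)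
    (hWc : ∀ g : Site 3 L → SU2, W g ≠ 0 → (∀ x, ‖su2Quat (g x) - 1‖ ≤ T) ∧ ‖∑ x, vecPart (g x)‖ ≤ Γ)
    {P : LinkSpace L → ℝ} (hPinv : ∀ (g : SU2) (x : LinkSpace L), P (adL L g x) = P x) {c₁ ηc Rin : ℝ} (hRin : Rin ≤ R)
    (hC1 : ∀ v'' : Edge 3 L → Fin 3 → ℝ, v'' ∈ capBalancedSet L → (∀ (e : Edge 3 L) (a : Fin 3), |v'' e a| ≤ T) → ‖linkEmbed L v''‖ ≤ Rin →
      |fpFibreTransfer L β Ω W (orthoTube L 1 v'') 1 - c₁ * P (linkEmbed L v'')| ≤ ηc * (c₁ * P (linkEmbed L v'')))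
    (u' u : GaugeConfig 3 1 SU2) (hu' : ∀ k : Fin 3, ‖su2Quat (u' (0, k)) - 1‖ ≤ δ) (hS' : (L : ℝ) ^ 3 * wilsonAction su2Rep u' ≤ σ)
    (hu : ∀ k : Fin 3, ‖su2Quat (u (0, k)) - 1‖ ≤ δu) (hS : (L : ℝ) ^ 3 * wilsonAction su2Rep u ≤ σ)
    {v' : Edge 3 L → Fin 3 → ℝ} (hv' : v' ∈ capBalancedSet L) (hv'T : ∀ e : Edge 3 L, ∑ a, v' e a ^ 2 ≤ T ^ 2) (hx' : ‖linkEmbed L v'‖ ≤ Rin) :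
    Real.exp (-(coreEta L β δ (δ + δu) T R Γ σ + coreEps1 L β δ T R + coreEps2 L β δ T R σ)) * (1 - ηc) *
        (c₁ * P (linkEmbed L v') * (avgKernel ((L : ℝ) ^ 3 * β) u' u / transferKernel su2Rep ((L : ℝ) ^ 3 * β) (1 : GaugeConfig 3 1 SU2) 1)) ≤
        ∫ c, fpFibreTransfer L β Ω W (gaugeTransform (fun _ : Site 3 L => c⁻¹) (orthoTube L u' v')) u ∂haarProbability SU2 ∧
      ∫ c, fpFibreTransfer L β Ω W (gaugeTransform (fun _ : Site 3 L => c⁻¹) (orthoTube L u' v')) u ∂haarProbability SU2 ≤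
        Real.exp (coreEta L β δ (δ + δu) T R Γ σ + coreEps1 L β δ T R + coreEps2 L β δ T R σ) * (1 + ηc) *
          (c₁ * P (linkEmbed L v') * (avgKernel ((L : ℝ) ^ 3 * β) u' u / transferKernel su2Rep ((L : ℝ) ^ 3 * β) (1 : GaugeConfig 3 1 SU2) 1)) := by
  haveI : SecondCountableTopology SU2 := secondCountableTopology_su2
  set B : ℝ := (L : ℝ) ^ 3 * β with hB
  set η : ℝ := coreEta L β δ (δ + δu) T R Γ σ + coreEps1 L β δ T R + coreEps2 L β δ T R σ with hη
  have hK1 : 0 < transferKernel su2Rep B (1 : GaugeConfig 3 1 SU2) 1 := transferKernel_pos _ _ _ _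
  -- the slow ratio `ρ(c) = K₁(c⁻¹u'c, u)/K₁(1,1)`: measurable, bounded, integrates to `K̃₁(u',u)/K₁(1,1)`
  set ρ : SU2 → ℝ := fun c => transferKernel su2Rep B (gaugeTransform (fun _ : Site 3 1 => c⁻¹) u') u / transferKernel su2Rep B (1 : GaugeConfig 3 1 SU2) 1 with hρ
  obtain ⟨M1, hM1⟩ := exists_transferKernel_le su2Rep continuous_su2Rep B (L := 1)
  have hρm : Measurable ρ := by
    have hK : Measurable fun p : GaugeConfig 3 1 SU2 × GaugeConfig 3 1 SU2 => transferKernel su2Rep B p.1 p.2 :=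
      (continuous_transferKernel su2Rep continuous_su2Rep B).measurable
    have hc : Measurable fun c : SU2 => gaugeTransform (fun _ : Site 3 1 => c⁻¹) u' := by
      have hcu : Measurable fun _ : SU2 => u' := measurable_const
      have h := (measurable_constGaugeAction (L := 1)).comp (hcu.prodMk measurable_inv)
      simpa only [Function.comp_def] using h
    have hu0 : Measurable fun _ : SU2 => u := measurable_const
    have h := hK.comp (hc.prodMk hu0)
    exact (by simpa only [Function.comp_def] using h : Measurable fun c : SU2 => transferKernel su2Rep B (gaugeTransform (fun _ : Site 3 1 => c⁻¹) u') u).div_const _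
  have hρ0 : ∀ c, 0 ≤ ρ c := fun c => div_nonneg (transferKernel_pos _ _ _ _).le hK1.le
  have hρb : ∀ c, |ρ c| ≤ M1 / transferKernel su2Rep B (1 : GaugeConfig 3 1 SU2) 1 := fun c => by
    rw [abs_of_nonneg (hρ0 c)]; exact div_le_div_of_nonneg_right (hM1 _ _) hK1.le
  have hρint : Integrable ρ (haarProbability SU2) := integrable_of_measurable_abs_le _ hρm hρb
  have hρI : ∫ c, ρ c ∂haarProbability SU2 = avgKernel B u' u / transferKernel su2Rep B (1 : GaugeConfig 3 1 SU2) 1 := by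
    rw [hρ, integral_div, ← avgKernel_one_eq_integral_conj]
  -- the colour integrand: measurable, bounded, and pointwise sandwiched
  set F : SU2 → ℝ := fun c => fpFibreTransfer L β Ω W (gaugeTransform (fun _ : Site 3 L => c⁻¹) (orthoTube L u' v')) u with hF
  have hFm : Measurable F := measurable_fpFibreTransfer_conj β hΩm hW _ u
  obtain ⟨BF, hBF⟩ := abs_fpFibreTransfer_le (L := L) β hCΩ hCW u
  have hFint : Integrable F (haarProbability SU2) := integrable_of_measurable_abs_le _ hFm fun c => hBF _
  have hpt : ∀ c : SU2, Real.exp (-η) * (1 - ηc) * (c₁ * P (linkEmbed L v')) * ρ c ≤ F c ∧ F c ≤ Real.exp η * (1 + ηc) * (c₁ * P (linkEmbed L v')) * ρ c := by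
    intro c
    -- the conjugated output point
    set u'' : GaugeConfig 3 1 SU2 := gaugeTransform (fun _ : Site 3 1 => c⁻¹) u' with hu''
    set v'' : Edge 3 L → Fin 3 → ℝ := colourRotate L (fun _ => c⁻¹) v' with hv''
    have hFc : F c = fpFibreTransfer L β Ω W (orthoTube L u'' v'') u := by rw [hF]; exact fpFibreTransfer_conj_orthoTube β Ω W c u' u hv'
    -- hypotheses of the transport at the conjugated point
    have hu''δ : ∀ k : Fin 3, ‖su2Quat (u'' (0, k)) - 1‖ ≤ δ := fun k => by
      rw [hu'']
      show ‖su2Quat (c⁻¹ * u' (0, k) * c⁻¹⁻¹) - 1‖ ≤ δ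
      rw [norm_su2Quat_conj_sub_one]; exact hu' k
    have hα : ∀ k : Fin 3, ‖su2Quat (u'' (0, k)) - su2Quat (u (0, k))‖ ≤ δ + δu := fun k => by
      calc ‖su2Quat (u'' (0, k)) - su2Quat (u (0, k))‖ = ‖(su2Quat (u'' (0, k)) - 1) + (1 - su2Quat (u (0, k)))‖ := by congr 1; abel
        _ ≤ ‖su2Quat (u'' (0, k)) - 1‖ + ‖1 - su2Quat (u (0, k))‖ := norm_add_le _ _
        _ ≤ δ + δu := add_le_add (hu''δ k) (by rw [norm_sub_rev]; exact hu k)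
    have hS'' : (L : ℝ) ^ 3 * wilsonAction su2Rep u'' ≤ σ := by rw [hu'', wilsonAction_gaugeTransform]; exact hS'
    have hv''cap : v'' ∈ capBalancedSet L := colourRotate_mem_capBalancedSet L hv'
    have hv''T : ∀ (e : Edge 3 L) (a : Fin 3), |v'' e a| ≤ T := fun e a => abs_colourRotate_apply_le hT0 hv'T _ e a
    have hx'' : linkEmbed L v'' = adL L c⁻¹ (linkEmbed L v') := by rw [hv'']; exact linkEmbed_colourRotate_const c⁻¹ v'
    have hx''Rin : ‖linkEmbed L v''‖ ≤ Rin := by rw [hx'', LinearIsometryEquiv.norm_map]; exact hx'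
    have hx''R : ‖linkEmbed L v''‖ ≤ R := hx''Rin.trans hRin
    have hPx : P (linkEmbed L v'') = P (linkEmbed L v') := by rw [hx'', hPinv]
    -- transport to the central fibre and the central quasimode
    have htr := fpFibreTransfer_two_sided_core hβ hΩm hCΩ hΩ0 hW hCW hW0 u'' u hv''cap hu''δ hδ1 hα hα1 hT hσ hS'' hS hv''T hx''R hΩt hWc
    have hq := abs_le.mp (hC1 v'' hv''cap hv''T hx''Rin)
    rw [hPx] at hq
    have hρc : transferKernel su2Rep ((L : ℝ) ^ 3 * β) u'' u / transferKernel su2Rep ((L : ℝ) ^ 3 * β) (1 : GaugeConfig 3 1 SU2) 1 = ρ c := by rw [hρ, hB]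
    rw [hρc, ← hη] at htr
    have hT1lo : (1 - ηc) * (c₁ * P (linkEmbed L v')) ≤ fpFibreTransfer L β Ω W (orthoTube L 1 v'') 1 := by linarith [hq.1]
    have hT1hi : fpFibreTransfer L β Ω W (orthoTube L 1 v'') 1 ≤ (1 + ηc) * (c₁ * P (linkEmbed L v')) := by linarith [hq.2]
    have he0 : 0 ≤ Real.exp (-η) * ρ c := mul_nonneg (Real.exp_pos _).le (hρ0 c)
    have he1 : 0 ≤ Real.exp η * ρ c := mul_nonneg (Real.exp_pos _).le (hρ0 c)
    rw [hFc]
    constructor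
    · calc Real.exp (-η) * (1 - ηc) * (c₁ * P (linkEmbed L v')) * ρ c = Real.exp (-η) * ρ c * ((1 - ηc) * (c₁ * P (linkEmbed L v'))) := by ring
        _ ≤ Real.exp (-η) * ρ c * fpFibreTransfer L β Ω W (orthoTube L 1 v'') 1 := mul_le_mul_of_nonneg_left hT1lo he0
        _ ≤ fpFibreTransfer L β Ω W (orthoTube L u'' v'') u := htr.1
    · calc fpFibreTransfer L β Ω W (orthoTube L u'' v'') u ≤ Real.exp η * ρ c * fpFibreTransfer L β Ω W (orthoTube L 1 v'') 1 := htr.2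
        _ ≤ Real.exp η * ρ c * ((1 + ηc) * (c₁ * P (linkEmbed L v'))) := mul_le_mul_of_nonneg_left hT1hi he1
        _ = Real.exp η * (1 + ηc) * (c₁ * P (linkEmbed L v')) * ρ c := by ring
  -- integrate over the colour
  have hFdef : ∫ c, fpFibreTransfer L β Ω W (gaugeTransform (fun _ : Site 3 L => c⁻¹) (orthoTube L u' v')) u ∂haarProbability SU2 = ∫ c, F c ∂haarProbability SU2 := rfl
  rw [hFdef]
  constructor
  · calc Real.exp (-η) * (1 - ηc) * (c₁ * P (linkEmbed L v') * (avgKernel B u' u / transferKernel su2Rep B (1 : GaugeConfig 3 1 SU2) 1))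
        = ∫ c, Real.exp (-η) * (1 - ηc) * (c₁ * P (linkEmbed L v')) * ρ c ∂haarProbability SU2 := by rw [integral_const_mul, hρI]; ring
      _ ≤ ∫ c, F c ∂haarProbability SU2 := integral_mono (hρint.const_mul _) hFint fun c => (hpt c).1
  · calc ∫ c, F c ∂haarProbability SU2 ≤ ∫ c, Real.exp η * (1 + ηc) * (c₁ * P (linkEmbed L v')) * ρ c ∂haarProbability SU2 :=
          integral_mono hFint (hρint.const_mul _) fun c => (hpt c).2
      _ = Real.exp η * (1 + ηc) * (c₁ * P (linkEmbed L v') * (avgKernel B u' u / transferKernel su2Rep B (1 : GaugeConfig 3 1 SU2) 1)) := by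
          rw [integral_const_mul, hρI]; ring

end Summit.QuantumFields.YangMills.Theorems.FemtoTransferGap.TwoLattice.ConstTube

end
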